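import Literature.Analysis.Calculus.WhitneyConvexPartition
import Literature.Analysis.Calculus.WhitneyConvexDilation
import HarnessLib

/-!
# The dilation–extrapolation extension operator on a compact convex body

Support file 6/7 for the planned proof of `Literature.Analysis.Calculus.WhitneyExtensionConvex`
(`WhitneyExtension.lean`; Whitney (1934), Thm. I, on closed convex sets with nonempty
interior).  For a compact convex body `K` containing the ball `closedBall c r` and a function
`f` of class `C^∞` on `K` (within), the **extension of order `n`** is

`extOp f K c r n = f` on `K`,  `= ∑_k Λ_k • approx f c n t_k` off `K`,

where `Λ_k = layer K ρ k` are the dyadic layers of `WhitneyConvexPartition.lean` at base scale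
`ρ = r / (8 · 2ⁿ)` and `approx f c n t_k` the dilation–extrapolation approximants of
`WhitneyConvexDilation.lean` at the scales `t_k = 1 / (2ⁿ 2ᵏ)`; the sum is locally finite off
`K`.  The scales are tuned so that on the support of `Λ_k` (where `ρ/(16·2ᵏ) < d < 2ρ/2ᵏ`) all
dilation ratios down to `1 - 2ⁿ t_k` send points into the interior of `K`
(`dil_mem_interior_of_infDist_lt`).  This file proves:

* `Literature.Analysis.Calculus.WhitneyConvex.extOp_eqOn` — `extOp = f` on `K`;
* `Literature.Analysis.Calculus.WhitneyConvex.contDiffOn_extOp` — `extOp` is `C^∞` off `K`;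
* `Literature.Analysis.Calculus.WhitneyConvex.extOp_eq_zero_of_le` — `extOp = 0` far from `K`;
* `Literature.Analysis.Calculus.WhitneyConvex.norm_iteratedFDeriv_extOp_sub_le` — **the key
  estimate**: for `γ ≤ n` and `ε > 0` there is `δ > 0` with
  `‖Dᵞ (extOp f K c r n) y - Dᵞ_K f (b)‖ ≤ ε` for all `y ∉ K`, `b ∈ K` with `d(y) < δ`,
  `‖y - b‖ < δ`.  Proof: near such `y`, with `k₀` an active layer,
  `extOp = approx_{k₀} + ∑_k Λ_k • (approx_k - approx_{k₀})` (the layers sum to `1` near `K`);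
  the first term is within `ε/2` of `Dᵞ_K f (b)` by the boundary estimate
  (`exists_boundary_bound`), and each of the at most five cross terms is bounded, by the
  Leibniz bound `norm_iteratedFDerivWithin_smul_le`, the layer bounds
  `‖Dⁱ Λ_k‖ ≤ C_i (2ᵏ/ρ)ⁱ` and the extrapolation estimate
  `‖Dᵝ approx_k - Dᵝ approx_{k₀}‖ ≤ C t^{n+1}` (`exists_extrapolation_bound`), by a constant
  times `2^{-k₀ (n + 1 - γ)} ≤ 2^{-k₀}`, small near `K`;
* whence, by the gluing theorem of `WhitneyConvexGluing.lean` (next file in the chain), the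
  extension of order `n` is of class `Cⁿ` with the jet of `f` on `K` — assembled there/in the
  final file.

## References

* H. Whitney, *Analytic extensions of differentiable functions defined in closed sets*, Trans.
  Amer. Math. Soc. 36 (1934), 63–89, §§9–11. [Whitney1934]
* E. M. Stein, *Singular Integrals and Differentiability Properties of Functions* (1970),
  Ch. VI, §2.2–2.3. [SteinSingularIntegrals1970]
-/

open Set Metric Filter Function Finset
open scoped ContDiff Topology Nat

noncomputable section

namespace Literature.Analysis.Calculus.WhitneyConvex

variable {E : Type*} [NormedAddCommGroup E] [NormedSpace ℝ E] [FiniteDimensional ℝ E]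
  [MeasurableSpace E] [BorelSpace E]
variable {F : Type*} [NormedAddCommGroup F] [NormedSpace ℝ F]

/-! ### Scales -/

/-- The base scale `ρ = r / (8 · 2ⁿ)` of the layers for the extension of order `n`. [folklore] -/
def baseScale (r : ℝ) (n : ℕ) : ℝ := r / (8 * 2 ^ n)

/-- The dilation scale `t_k = 1 / (2ⁿ 2ᵏ)` of the `k`-th layer. [folklore] -/
def layerScale (n k : ℕ) : ℝ := 1 / (2 ^ n * 2 ^ k)

/-- `ρ > 0` for `r > 0`. [folklore] -/
theorem baseScale_pos {r : ℝ} (hr : 0 < r) (n : ℕ) : 0 < baseScale r n := by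
  unfold baseScale; positivity

/-- `t_k > 0`. [folklore] -/
theorem layerScale_pos (n k : ℕ) : 0 < layerScale n k := by
  unfold layerScale; positivity

/-- `2ⁿ t_k = 1 / 2ᵏ ≤ 1`. [folklore] -/
theorem two_pow_mul_layerScale (n k : ℕ) : 2 ^ n * layerScale n k = 1 / 2 ^ k := by
  unfold layerScale; field_simp

/-- `2ⁿ t_k ≤ 1`. [folklore] -/
theorem two_pow_mul_layerScale_le_one (n k : ℕ) : 2 ^ n * layerScale n k ≤ 1 := by
  rw [two_pow_mul_layerScale, div_le_one (by positivity)]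
  exact one_le_pow₀ (by norm_num)

/-- `t_{k+1} = t_k / 2`: the scales decrease. [folklore] -/
theorem layerScale_succ (n k : ℕ) : layerScale n (k + 1) = layerScale n k / 2 := by
  unfold layerScale; rw [pow_succ]; field_simp

/-- The scales are antitone in `k`. [folklore] -/
theorem layerScale_le_of_le (n : ℕ) {k k' : ℕ} (h : k ≤ k') : layerScale n k' ≤ layerScale n k := by
  unfold layerScale
  have : (2 : ℝ) ^ k ≤ 2 ^ k' := pow_le_pow_right₀ (by norm_num) h
  have h0 : (0 : ℝ) < 2 ^ n * 2 ^ k := by positivity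
  exact one_div_le_one_div_of_le h0 (by nlinarith [pow_pos (two_pos : (0:ℝ) < 2) n])

/-- The scales are strictly antitone in `k`. [folklore] -/
theorem layerScale_lt_of_lt (n : ℕ) {k k' : ℕ} (h : k < k') : layerScale n k' < layerScale n k := by
  unfold layerScale
  have : (2 : ℝ) ^ k < 2 ^ k' := pow_lt_pow_right₀ (by norm_num) h
  have h0 : (0 : ℝ) < 2 ^ n * 2 ^ k := by positivity
  exact one_div_lt_one_div_of_lt h0 (by nlinarith [pow_pos (two_pos : (0:ℝ) < 2) n])

/-- The tuning identity: `t_k r = 8 ρ / 2ᵏ`. [folklore] -/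
theorem layerScale_mul_eq {r : ℝ} (n k : ℕ) : layerScale n k * r = 8 * baseScale r n / 2 ^ k := by
  unfold layerScale baseScale; field_simp

/-- Comparable layers have comparable scales: `t_k ≤ 4 t_{k'}` for `k' ≤ k + 2`. [folklore] -/
theorem layerScale_le_four_mul (n : ℕ) {k k' : ℕ} (h : k' ≤ k + 2) :
    layerScale n k' ≥ layerScale n (k + 2) := layerScale_le_of_le n h

/-- `t_{k+2} = t_k / 4`. [folklore] -/
theorem layerScale_add_two (n k : ℕ) : layerScale n (k + 2) = layerScale n k / 4 := by
  rw [layerScale_succ, layerScale_succ]; ring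

/-! ### The operator -/

section Operator

variable (f : E → F) (K : Set E) (c : E) (r : ℝ) (n : ℕ)

/-- The `k`-th term `Λ_k • approx f c n t_k` of the extension operator. [folklore] -/
def extTerm (k : ℕ) (x : E) : F :=
  layer K (baseScale r n) k x • approx f c n (layerScale n k) x

open scoped Classical in
/-- **The dilation–extrapolation extension of order `n`**: `f` on `K`, `∑_k Λ_k • approx_k`
off `K`. [folklore] -/
def extOp (x : E) : F :=
  if x ∈ K then f x else ∑' k : ℕ, extTerm f K c r n k x

variable {f K c r n}

/-- On `K`, `extOp = f`. [folklore] -/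
theorem extOp_of_mem {x : E} (hx : x ∈ K) : extOp f K c r n x = f x := by
  unfold extOp; rw [if_pos hx]

/-- `extOp = f` on `K`. [folklore] -/
theorem extOp_eqOn : EqOn (extOp f K c r n) f K := fun _ hx => extOp_of_mem hx

/-- Off `K`, `extOp` is the series. [folklore] -/
theorem extOp_of_notMem {x : E} (hx : x ∉ K) : extOp f K c r n x = ∑' k : ℕ, extTerm f K c r n k x := by
  unfold extOp; rw [if_neg hx]

/-- Beyond the last active layer the terms vanish: if `2ᴺ Δ(x) ≥ 4ρ` then `extTerm k x = 0`
for `k ≥ N` (at the point; off `K`). [folklore] -/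
theorem extTerm_eq_zero_of_le {r : ℝ} (hr : 0 < r) {x : E} (hx : 0 < infDist x K) {N k : ℕ}
    (hN : 4 * baseScale r n ≤ 2 ^ N * regDist K x) (hk : N ≤ k) : extTerm f K c r n k x = 0 := by
  have h := (eventually_layer_eq_zero (baseScale_pos hr n) hx hN).self_of_nhds k hk
  rw [extTerm, h, zero_smul]

/-- Off `K` the series is a finite sum: if `2ᴺ Δ(x) ≥ 4ρ` then `extOp x = ∑_{k<N} extTerm k x`.
[folklore] -/
theorem extOp_eq_sum {r : ℝ} (hr : 0 < r) {x : E} (hxK : x ∉ K) (hx : 0 < infDist x K) {N : ℕ}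
    (hN : 4 * baseScale r n ≤ 2 ^ N * regDist K x) :
    extOp f K c r n x = ∑ k ∈ range N, extTerm f K c r n k x := by
  rw [extOp_of_notMem hxK]
  refine tsum_eq_sum fun k hk => ?_
  exact extTerm_eq_zero_of_le hr hx hN (not_lt.1 fun h => hk (mem_range.2 h))

/-- **Local finiteness**: near a point off the closed set `K`, `extOp` is a fixed finite sum
of terms. [folklore] -/
theorem extOp_eventuallyEq_sum {r : ℝ} (hr : 0 < r) {x₀ : E}
    (hx₀ : 0 < infDist x₀ K) {N : ℕ} (hN : 4 * baseScale r n ≤ 2 ^ N * regDist K x₀) :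
    extOp f K c r n =ᶠ[𝓝 x₀] fun x => ∑ k ∈ range N, extTerm f K c r n k x := by
  have hev := eventually_layer_eq_zero (baseScale_pos hr n) hx₀ hN
  have hopen : ∀ᶠ x in 𝓝 x₀, 0 < infDist x K := (isOpen_offSet K).mem_nhds hx₀
  filter_upwards [hev, hopen] with x hx hxpos
  have hxK : x ∉ K := fun h => by
    have := infDist_zero_of_mem h
    linarith
  rw [extOp_of_notMem hxK]
  refine tsum_eq_sum fun k hk => ?_
  rw [extTerm, hx k (not_lt.1 fun h => hk (mem_range.2 h)), zero_smul]

end Operator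

/-! ### Geometry: dilates of points near `K` are interior -/

section Geometry

variable {K : Set E} {c : E} {r : ℝ}

omit [FiniteDimensional ℝ E] [MeasurableSpace E] [BorelSpace E] in
/-- **Dilates of points near `K` are interior**: for a compact convex `K` with
`closedBall c r ⊆ K`, a point `y` with `d(y) < (1 - μ) r` and `0 ≤ μ ≤ 1` is dilated into the
interior of `K` (through a nearest point). [folklore] -/
theorem dil_mem_interior_of_infDist_lt (hK : Convex ℝ K) (hKc : IsCompact K) (hne : K.Nonempty)
    (hball : closedBall c r ⊆ K) {μ : ℝ} (hμ0 : 0 ≤ μ) (hμ1 : μ ≤ 1) {y : E}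
    (hy : infDist y K < (1 - μ) * r) : dil c μ y ∈ interior K := by
  obtain ⟨b, hb, hbd⟩ := hKc.exists_infDist_eq_dist hne y
  refine dil_mem_interior_of_le hK hball hb hμ0 hμ1 (δ := infDist y K) ?_ hy
  rw [← dist_eq_norm, ← hbd]

omit [FiniteDimensional ℝ E] [MeasurableSpace E] [BorelSpace E] in
/-- **The tuning**: a point with `d(y) < 8ρ/2ᵏ = t_k r` is dilated into the interior of `K` by
every ratio `μ ∈ [0, 1 - t_k]`. [folklore] -/
theorem dil_mem_interior_of_scale (hK : Convex ℝ K) (hKc : IsCompact K) (hne : K.Nonempty)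
    (hball : closedBall c r ⊆ K) (hr : 0 < r) (n k : ℕ) {y : E}
    (hy : infDist y K < 8 * baseScale r n / 2 ^ k) {μ : ℝ} (hμ0 : 0 ≤ μ)
    (hμ : μ ≤ 1 - layerScale n k) : dil c μ y ∈ interior K := by
  have ht : 0 < layerScale n k := layerScale_pos n k
  refine dil_mem_interior_of_infDist_lt hK hKc hne hball hμ0 (by linarith) ?_
  have h1 : layerScale n k * r ≤ (1 - μ) * r := mul_le_mul_of_nonneg_right (by linarith) hr.le
  refine lt_of_lt_of_le ?_ h1
  rwa [layerScale_mul_eq]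

omit [FiniteDimensional ℝ E] [MeasurableSpace E] [BorelSpace E] in
/-- The node dilates of a point with `d(y) < 8ρ/2ᵏ` at any scale `t_{k'}`, `k' ≤ k`, are
interior: `y ∈ goodSet (interior K) c n t_{k'}`. [folklore] -/
theorem mem_goodSet_of_infDist_lt (hK : Convex ℝ K) (hKc : IsCompact K) (hne : K.Nonempty)
    (hball : closedBall c r ⊆ K) (hr : 0 < r) (n : ℕ) {k k' : ℕ} (hk' : k' ≤ k) {y : E}
    (hy : infDist y K < 8 * baseScale r n / 2 ^ k) :
    y ∈ goodSet (interior K) c n (layerScale n k') := by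
  intro j hj
  have ht0 : 0 ≤ layerScale n k' := (layerScale_pos n k').le
  refine dil_mem_interior_of_scale hK hKc hne hball hr n k hy ?_ ?_
  · -- `μ_j ≥ 1 - 2ⁿ t_{k'} ≥ 0`
    have h1 : (2 : ℝ) ^ j * layerScale n k' ≤ 2 ^ n * layerScale n k' :=
      mul_le_mul_of_nonneg_right (pow_le_pow_right₀ (by norm_num) (by omega)) ht0
    have h2 := two_pow_mul_layerScale_le_one n k'
    rw [dnode_apply]; linarith
  · exact (dnode_le j ht0).trans (by linarith [layerScale_le_of_le n hk'])

omit [FiniteDimensional ℝ E] [MeasurableSpace E] [BorelSpace E] in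
/-- The segment condition of the extrapolation estimate between the scales `t_{k₁} > t_{k₂}`
(`k₁ ≤ k₂ ≤ k`) at a point with `d(y) < 8ρ/2ᵏ`. [folklore] -/
theorem segment_interior_of_infDist_lt (hK : Convex ℝ K) (hKc : IsCompact K) (hne : K.Nonempty)
    (hball : closedBall c r ⊆ K) (hr : 0 < r) (n : ℕ) {k k₁ k₂ : ℕ} (hk₂ : k₂ ≤ k) {y : E}
    (hy : infDist y K < 8 * baseScale r n / 2 ^ k) :
    ∀ μ ∈ Icc (1 - 2 ^ n * layerScale n k₁) (1 - layerScale n k₂), dil c μ y ∈ interior K := by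
  intro μ hμ
  have h2 := two_pow_mul_layerScale_le_one n k₁
  exact dil_mem_interior_of_scale hK hKc hne hball hr n k hy (by linarith [hμ.1])
    (hμ.2.trans (by linarith [layerScale_le_of_le n hk₂]))

end Geometry

/-! ### Smoothness off `K` -/

section Smooth

variable {f : E → F} {K : Set E} {c : E} {r : ℝ} {n : ℕ}

/-- Where a layer can be active the distance is small: `Λ_k(y) ≠ 0` forces `d(y) < 2ρ/2ᵏ`, so
if `d(y) ≥ 8ρ/2ᵏ` then `Λ_k = 0` near `y` (continuity of `d`). [folklore] -/
theorem layer_eventuallyEq_zero_of_le {r : ℝ} (hr : 0 < r) (n k : ℕ) {y : E}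
    (hy : 8 * baseScale r n / 2 ^ k ≤ infDist y K) :
    layer K (baseScale r n) k =ᶠ[𝓝 y] (0 : E → ℝ) := by
  have hρ := baseScale_pos hr n
  have h2k : (0 : ℝ) < 2 ^ k := by positivity
  have hlt : 2 * baseScale r n / 2 ^ k < infDist y K := by
    refine lt_of_lt_of_le ?_ hy
    exact div_lt_div_of_pos_right (by linarith) h2k
  have hev : ∀ᶠ y' in 𝓝 y, 2 * baseScale r n / 2 ^ k < infDist y' K :=
    (continuous_infDist_pt K).continuousAt.eventually (lt_mem_nhds hlt)
  filter_upwards [hev] with y' hy'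
  by_contra hne
  have hpos : 0 < infDist y' K := lt_of_le_of_lt (by positivity) hy'
  exact absurd (infDist_lt_of_layer_ne_zero hρ hpos hne) (not_lt.2 hy'.le)

variable (hK : Convex ℝ K) (hKc : IsCompact K) (hball : closedBall c r ⊆ K) (hr : 0 < r)
  (hf : ContDiffOn ℝ ∞ f K)
include hK hKc hball hr hf

omit [FiniteDimensional ℝ E] [MeasurableSpace E] [BorelSpace E] in
/-- The approximant at scale `t_k` is smooth at points with `d(y) < 8ρ/2ᵏ`. [folklore] -/
theorem contDiffAt_approx_of_infDist_lt (k : ℕ) {y : E}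
    (hy : infDist y K < 8 * baseScale r n / 2 ^ k) :
    ContDiffAt ℝ ∞ (approx f c n (layerScale n k)) y :=
  contDiffAt_approx isOpen_interior (hf.mono interior_subset) c n _
    (mem_goodSet_of_infDist_lt hK hKc ⟨c, hball (mem_closedBall_self hr.le)⟩ hball hr n le_rfl hy)

/-- **Each term `Λ_k • approx_k` is smooth off `K`** (where `d < 8ρ/2ᵏ` both factors are smooth;
elsewhere the layer vanishes identically nearby). [folklore] -/
theorem contDiffAt_extTerm (k : ℕ) {y : E} (hy : 0 < infDist y K) :
    ContDiffAt ℝ ∞ (extTerm f K c r n k) y := by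
  by_cases h : infDist y K < 8 * baseScale r n / 2 ^ k
  · exact (((contDiffOn_layer K _ k).contDiffAt ((isOpen_offSet K).mem_nhds hy))).smul
      (contDiffAt_approx_of_infDist_lt hK hKc hball hr hf k h)
  · have hev := layer_eventuallyEq_zero_of_le (K := K) hr n k (not_lt.1 h)
    have hev' : extTerm f K c r n k =ᶠ[𝓝 y] fun _ => (0 : F) := by
      filter_upwards [hev] with y' hy'
      rw [extTerm, hy', Pi.zero_apply, zero_smul]
    exact (contDiffAt_const (c := (0 : F))).congr_of_eventuallyEq hev'

/-- **`extOp` is `C^∞` off `K`** (locally a finite sum of smooth terms). [folklore] -/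
theorem contDiffAt_extOp {y : E} (hy : 0 < infDist y K) : ContDiffAt ℝ ∞ (extOp f K c r n) y := by
  obtain ⟨N, hN⟩ := exists_pow_mul_regDist_ge (baseScale r n) hy 4
  have hev := extOp_eventuallyEq_sum (f := f) (K := K) (c := c) (n := n) hr hy hN
  refine ContDiffAt.congr_of_eventuallyEq ?_ hev
  exact ContDiffAt.sum fun k _ => contDiffAt_extTerm hK hKc hball hr hf k hy

/-- `extOp` is `C^∞` on `{d > 0}`. [folklore] -/
theorem contDiffOn_extOp : ContDiffOn ℝ ∞ (extOp f K c r n) (offSet K) := fun _ hy =>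
  (contDiffAt_extOp hK hKc hball hr hf hy).contDiffWithinAt

omit hK hKc hball hf in
/-- Far from `K` the extension vanishes: `extOp y = 0` if `y ∉ K` and `Δ(y) ≥ 2ρ`. [folklore] -/
theorem extOp_eq_zero_of_le {y : E} (hyK : y ∉ K) (hy : 2 * baseScale r n ≤ regDist K y) :
    extOp f K c r n y = 0 := by
  rw [extOp_of_notMem hyK]
  have h : ∀ k, extTerm f K c r n k y = 0 := fun k => by
    rw [extTerm]
    by_cases hl : layer K (baseScale r n) k y = 0
    · rw [hl, zero_smul]
    · exfalso
      have h1 := (regDist_mem_of_layer_ne_zero (baseScale_pos hr n) hl).2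
      have h2 : regDist K y ≤ 2 ^ k * regDist K y := by
        have := one_le_pow₀ (M₀ := ℝ) (a := 2) (n := k) (by norm_num)
        have h0 : 0 ≤ regDist K y := le_trans (by have := baseScale_pos hr n; positivity) hy
        nlinarith
      linarith
  simp_rw [h, tsum_zero]

end Smooth

/-! ### The key estimate -/

section Estimate

variable {f : E → F} {K : Set E} {c : E} {r : ℝ} {n : ℕ}
variable (hK : Convex ℝ K) (hKc : IsCompact K) (hball : closedBall c r ⊆ K) (hr : 0 < r)
  (hf : ContDiffOn ℝ ∞ f K)
include hK hKc hball hr hf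

omit hK hKc hball hf in
/-- Near a point `y` off `K` with `Δ(y) < ρ` (so that the layers sum to `1` near `y`), for any
`k₀`: `extOp = approx_{k₀} + ∑_{k<N} Λ_k • (approx_k - approx_{k₀})` near `y`. [folklore] -/
theorem extOp_eventuallyEq_cross {y : E} (hy : 0 < infDist y K)
    (hΔ : regDist K y < baseScale r n) {N : ℕ} (hN : 4 * baseScale r n ≤ 2 ^ N * regDist K y)
    (k₀ : ℕ) :
    extOp f K c r n =ᶠ[𝓝 y] fun x => approx f c n (layerScale n k₀) x +
      ∑ k ∈ range N, layer K (baseScale r n) k x •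
        (approx f c n (layerScale n k) x - approx f c n (layerScale n k₀) x) := by
  have hρ := baseScale_pos hr n
  have h1 := extOp_eventuallyEq_sum (f := f) (K := K) (c := c) (n := n) hr hy hN
  have h2 := eventually_sum_range_layer hρ hy hN
  have h3 : ∀ᶠ x in 𝓝 y, regDist K x < baseScale r n :=
    (continuousAt_regDist hy).eventually (gt_mem_nhds hΔ)
  filter_upwards [h1, h2, h3] with x hx1 hx2 hx3
  have hsum1 : ∑ k ∈ range N, layer K (baseScale r n) k x = 1 := by
    rw [hx2 N le_rfl, dyadicCutoff_of_le_one ((div_le_one hρ).2 hx3.le)]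
  rw [hx1]
  simp only [extTerm]
  rw [show ∑ k ∈ range N, layer K (baseScale r n) k x • approx f c n (layerScale n k) x =
      ∑ k ∈ range N, (layer K (baseScale r n) k x • approx f c n (layerScale n k₀) x +
        layer K (baseScale r n) k x •
          (approx f c n (layerScale n k) x - approx f c n (layerScale n k₀) x)) from
      sum_congr rfl fun k _ => by rw [smul_sub, add_sub_cancel],
    sum_add_distrib, ← sum_smul, hsum1, one_smul]

/-- The cross terms are smooth at points with `d(y) < 8ρ/2^{k₀}`. [folklore] -/
theorem contDiffAt_cross (k k₀ : ℕ) {y : E} (hy : 0 < infDist y K)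
    (hk₀ : infDist y K < 8 * baseScale r n / 2 ^ k₀) :
    ContDiffAt ℝ ∞ (fun x => layer K (baseScale r n) k x •
      (approx f c n (layerScale n k) x - approx f c n (layerScale n k₀) x)) y := by
  by_cases h : infDist y K < 8 * baseScale r n / 2 ^ k
  · exact ((contDiffOn_layer K _ k).contDiffAt ((isOpen_offSet K).mem_nhds hy)).smul
      ((contDiffAt_approx_of_infDist_lt hK hKc hball hr hf k h).sub
        (contDiffAt_approx_of_infDist_lt hK hKc hball hr hf k₀ hk₀))
  · have hev := layer_eventuallyEq_zero_of_le (K := K) hr n k (not_lt.1 h)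
    refine (contDiffAt_const (c := (0 : F))).congr_of_eventuallyEq ?_
    filter_upwards [hev] with y' hy'
    rw [hy', Pi.zero_apply, zero_smul]

/-- **The derivatives of `extOp` near `K`**: at `y` off `K` with `Δ(y) < ρ` and
`d(y) < 8ρ/2^{k₀}`, `Dᵞ extOp (y) = Dᵞ approx_{k₀} (y) + ∑_{k<N} Dᵞ (Λ_k • (approx_k - approx_{k₀})) (y)`.
[folklore] -/
theorem iteratedFDeriv_extOp_eq {y : E} (hy : 0 < infDist y K) (hΔ : regDist K y < baseScale r n)
    {N : ℕ} (hN : 4 * baseScale r n ≤ 2 ^ N * regDist K y) {k₀ : ℕ}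
    (hk₀ : infDist y K < 8 * baseScale r n / 2 ^ k₀) (γ : ℕ) :
    iteratedFDeriv ℝ γ (extOp f K c r n) y =
      iteratedFDeriv ℝ γ (approx f c n (layerScale n k₀)) y +
      ∑ k ∈ range N, iteratedFDeriv ℝ γ (fun x => layer K (baseScale r n) k x •
        (approx f c n (layerScale n k) x - approx f c n (layerScale n k₀) x)) y := by
  have hev := extOp_eventuallyEq_cross (f := f) (c := c) hr hy hΔ hN k₀
  rw [(hev.iteratedFDeriv ℝ γ).eq_of_nhds]
  have h1 : ContDiffAt ℝ γ (approx f c n (layerScale n k₀)) y :=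
    (contDiffAt_approx_of_infDist_lt hK hKc hball hr hf k₀ hk₀).of_le (by exact_mod_cast le_top)
  have h2 : ∀ k ∈ range N, ContDiffAt ℝ γ (fun x => layer K (baseScale r n) k x •
      (approx f c n (layerScale n k) x - approx f c n (layerScale n k₀) x)) y := fun k _ =>
    (contDiffAt_cross hK hKc hball hr hf k k₀ hy hk₀).of_le (by exact_mod_cast le_top)
  rw [fun_iteratedFDeriv_add_apply h1 (ContDiffAt.sum h2), iteratedFDeriv_fun_sum_apply h2]

omit [NormedSpace ℝ E] [FiniteDimensional ℝ E] [MeasurableSpace E] [BorelSpace E] hK hball hr hf in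
/-- A radius `R` with `K ⊆ closedBall c R`. [folklore] -/
theorem exists_radius : ∃ R : ℝ, 0 ≤ R ∧ K ⊆ closedBall c R := by
  obtain ⟨R, hR⟩ := hKc.isBounded.subset_closedBall c
  exact ⟨max R 0, le_max_right _ _, hR.trans (closedBall_subset_closedBall (le_max_left _ _))⟩

omit [NormedSpace ℝ E] [FiniteDimensional ℝ E] [MeasurableSpace E] [BorelSpace E] hK hball hr hf in
/-- Points near `K` are in a fixed ball about `c`. [folklore] -/
theorem norm_sub_center_le {R : ℝ} (hR : K ⊆ closedBall c R) (hne : K.Nonempty) {y : E} {δ : ℝ}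
    (hy : infDist y K ≤ δ) : ‖y - c‖ ≤ R + δ := by
  obtain ⟨b, hb, hbd⟩ := hKc.exists_infDist_eq_dist hne y
  calc ‖y - c‖ ≤ ‖y - b‖ + ‖b - c‖ := norm_sub_le_norm_sub_add_norm_sub _ _ _
    _ ≤ δ + R := add_le_add (by rw [← dist_eq_norm, ← hbd]; exact hy)
        (by rw [← dist_eq_norm]; exact hR hb)
    _ = R + δ := add_comm _ _

/-- **Bound for one cross term.**  For `γ ≤ n` there is `C` such that at a point `y` off `K`
where the layer `k₀` is active (`ρ/2 < 2^{k₀} Δ(y) < 2ρ`),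
`‖Dᵞ (Λ_k • (approx_k - approx_{k₀})) (y)‖ ≤ C / 2^{k₀}` for every `k` — and the derivative
vanishes unless `k = k₀ ± 1` (the layer `k` is inactive near `y`, or `k = k₀`).  Leibniz bound,
layer bounds, extrapolation estimate. [folklore] -/
theorem exists_bound_cross (γ : ℕ) (hγ : γ ≤ n) :
    ∃ C : ℝ, 0 ≤ C ∧ ∀ (k k₀ : ℕ) (y : E), 0 < infDist y K →
      baseScale r n / 2 < 2 ^ k₀ * regDist K y → 2 ^ k₀ * regDist K y < 2 * baseScale r n →
      ‖iteratedFDeriv ℝ γ (fun x => layer K (baseScale r n) k x •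
        (approx f c n (layerScale n k) x - approx f c n (layerScale n k₀) x)) y‖ ≤ C / 2 ^ k₀ ∧
      ((k ≠ k₀ - 1 ∧ k ≠ k₀ + 1) → iteratedFDeriv ℝ γ (fun x => layer K (baseScale r n) k x •
        (approx f c n (layerScale n k) x - approx f c n (layerScale n k₀) x)) y = 0) := by
  have hρ := baseScale_pos hr n
  have hne : K.Nonempty := ⟨c, hball (mem_closedBall_self hr.le)⟩
  have hKu : UniqueDiffOn ℝ K :=
    uniqueDiffOn_convex hK ⟨c, interior_mono hball (by
      rw [interior_closedBall c hr.ne']; exact mem_ball_self hr)⟩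
  obtain ⟨R₀, hR₀0, hR₀⟩ := exists_radius (c := c) hKc
  set R : ℝ := R₀ + 2 * baseScale r n with hR
  -- constants of the extrapolation estimate, all orders `β ≤ γ`
  have hext : ∀ β : ℕ, ∃ C : ℝ, 0 ≤ C ∧ ∀ x : E, ‖x - c‖ ≤ R → ∀ t t' : ℝ, 0 < t' → t' < t →
      2 ^ n * t ≤ 1 → (∀ μ ∈ Icc (1 - 2 ^ n * t) (1 - t'), dil c μ x ∈ interior K) →
      ‖iteratedFDeriv ℝ β (approx f c n t) x - iteratedFDeriv ℝ β (approx f c n t') x‖ ≤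
        C * t ^ (n + 1) := fun β => exists_extrapolation_bound hf hKu hKc c β n R
  choose Cx hCx0 hCx using hext
  set Cmax : ℝ := ∑ β ∈ range (γ + 1), Cx β with hCmax
  have hCmax0 : 0 ≤ Cmax := sum_nonneg fun β _ => hCx0 β
  have hCx_le : ∀ β, β ≤ γ → Cx β ≤ Cmax := fun β hβ =>
    single_le_sum (f := Cx) (fun β _ => hCx0 β) (mem_range.2 (Nat.lt_succ_of_le hβ))
  set Lmax : ℝ := ∑ i ∈ range (γ + 1), layerBound E i with hLmax
  have hLmax0 : 0 ≤ Lmax := sum_nonneg fun i _ => layerBound_nonneg i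
  have hL_le : ∀ i, i ≤ γ → layerBound E i ≤ Lmax := fun i hi =>
    single_le_sum (f := layerBound E) (fun i _ => layerBound_nonneg i)
      (mem_range.2 (Nat.lt_succ_of_le hi))
  set A₀ : ℝ := max 1 ((2 / baseScale r n) ^ γ) with hA₀
  have hA₀1 : 1 ≤ A₀ := le_max_left _ _
  -- the constant
  refine ⟨2 ^ γ * Lmax * Cmax * 2 ^ (n + 1) * A₀, by positivity, fun k k₀ y hy hk₀l hk₀u => ?_⟩
  set ρ := baseScale r n with hρ_def
  set Φ : E → F := fun x => layer K ρ k x •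
    (approx f c n (layerScale n k) x - approx f c n (layerScale n k₀) x) with hΦ
  have h2k₀ : (0 : ℝ) < 2 ^ k₀ := by positivity
  have hCfin0 : 0 ≤ 2 ^ γ * Lmax * Cmax * 2 ^ (n + 1) * A₀ / 2 ^ k₀ := by positivity
  -- distance facts at `y`
  have hΔy : regDist K y < 2 * ρ / 2 ^ k₀ := by rw [lt_div_iff₀ h2k₀]; linarith
  have hdy : infDist y K < 2 * ρ / 2 ^ k₀ := (infDist_le_regDist hy).trans_lt hΔy
  have hdy8 : infDist y K < 8 * ρ / 2 ^ (k₀ + 2) := by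
    rw [pow_add]; convert hdy using 1; field_simp; norm_num
  -- if the layer `k` vanishes identically near `y`, everything is zero
  have hzero : layer K ρ k =ᶠ[𝓝 y] (0 : E → ℝ) → iteratedFDeriv ℝ γ Φ y = 0 := fun hev => by
    have hev' : Φ =ᶠ[𝓝 y] (0 : E → F) := by
      filter_upwards [hev] with x hx
      simp only [hΦ, Pi.zero_apply] at hx ⊢
      rw [hx, zero_smul]
    rw [(hev'.iteratedFDeriv ℝ γ).eq_of_nhds, iteratedFDeriv_zero, Pi.zero_apply]
  by_cases hact : ρ / 2 ≤ 2 ^ k * regDist K y ∧ 2 ^ k * regDist K y ≤ 2 * ρ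
  swap
  · -- inactive: `Λ_k = 0` near `y`
    have hev : layer K ρ k =ᶠ[𝓝 y] (0 : E → ℝ) := by
      have hc : ContinuousAt (fun x => 2 ^ k * regDist K x) y :=
        continuousAt_const.mul (continuousAt_regDist hy)
      rcases not_and_or.1 hact with h | h
      · filter_upwards [hc.eventually (gt_mem_nhds (lt_of_not_ge h))] with x hx
        by_contra hne
        exact absurd (regDist_mem_of_layer_ne_zero hρ hne).1 (not_lt.2 hx.le)
      · filter_upwards [hc.eventually (lt_mem_nhds (lt_of_not_ge h))] with x hx
        by_contra hne
        exact absurd (regDist_mem_of_layer_ne_zero hρ hne).2 (not_lt.2 hx.le)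
    have h0 := hzero hev
    exact ⟨by rw [h0, norm_zero]; exact hCfin0, fun _ => h0⟩
  -- active: `k ∈ {k₀ - 1, k₀, k₀ + 1}`
  have hΔpos : 0 < regDist K y := regDist_pos hy
  have hk_le : k ≤ k₀ + 1 := by
    by_contra hlt
    have hk2 : k₀ + 2 ≤ k := by omega
    have h1 : (2 : ℝ) ^ (k₀ + 2) ≤ 2 ^ k := pow_le_pow_right₀ (by norm_num) hk2
    have h2 : 2 ^ (k₀ + 2) * regDist K y ≤ 2 ^ k * regDist K y :=
      mul_le_mul_of_nonneg_right h1 hΔpos.le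
    rw [pow_add] at h2
    nlinarith [hact.2]
  have hk_ge : k₀ ≤ k + 1 := by
    by_contra hlt
    have hk2 : k + 2 ≤ k₀ := by omega
    have h1 : (2 : ℝ) ^ (k + 2) ≤ 2 ^ k₀ := pow_le_pow_right₀ (by norm_num) hk2
    have h2 : 2 ^ (k + 2) * regDist K y ≤ 2 ^ k₀ * regDist K y :=
      mul_le_mul_of_nonneg_right h1 hΔpos.le
    rw [pow_add] at h2
    nlinarith [hact.1]
  by_cases hkk : k = k₀
  · -- `k = k₀`: the cross term is zero
    have h0 : iteratedFDeriv ℝ γ Φ y = 0 := by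
      have : Φ = (0 : E → F) := by
        funext x; simp only [hΦ, hkk, sub_self, smul_zero, Pi.zero_apply]
      rw [this, iteratedFDeriv_zero, Pi.zero_apply]
    exact ⟨by rw [h0, norm_zero]; exact hCfin0, fun _ => h0⟩
  -- `k = k₀ ± 1`
  have hk_cases : k = k₀ - 1 ∨ k = k₀ + 1 := by omega
  refine ⟨?_, fun h => absurd hk_cases (not_or.2 h)⟩
  -- smoothness of the two approximants at `y` (both scales `≤ k₀ + 2`… indices `≤ k₀ + 2`)
  have hgood_k : y ∈ goodSet (interior K) c n (layerScale n k) :=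
    mem_goodSet_of_infDist_lt hK hKc hne hball hr n (by omega : k ≤ k₀ + 2) hdy8
  have hgood_k₀ : y ∈ goodSet (interior K) c n (layerScale n k₀) :=
    mem_goodSet_of_infDist_lt hK hKc hne hball hr n (by omega : k₀ ≤ k₀ + 2) hdy8
  -- the open set for the Leibniz bound
  set sO : Set E := offSet K ∩ (goodSet (interior K) c n (layerScale n k) ∩
    goodSet (interior K) c n (layerScale n k₀)) with hsO
  have hsO_open : IsOpen sO := (isOpen_offSet K).inter
    ((isOpen_goodSet isOpen_interior c n _).inter (isOpen_goodSet isOpen_interior c n _))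
  have hysO : y ∈ sO := ⟨hy, hgood_k, hgood_k₀⟩
  have hf' : ContDiffOn ℝ ∞ f (interior K) := hf.mono interior_subset
  have h1 : ContDiffOn ℝ ∞ (layer K ρ k) sO := (contDiffOn_layer K ρ k).mono inter_subset_left
  have h2 : ContDiffOn ℝ ∞ (fun x => approx f c n (layerScale n k) x -
      approx f c n (layerScale n k₀) x) sO :=
    ((contDiffOn_approx isOpen_interior hf' c n _).mono fun x hx => hx.2.1).sub
      ((contDiffOn_approx isOpen_interior hf' c n _).mono fun x hx => hx.2.2)
  have hleib := norm_iteratedFDerivWithin_smul_le (N := ∞) h1 h2 hsO_open.uniqueDiffOn hysO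
    (n := γ) (by exact_mod_cast le_top)
  rw [(iteratedFDerivWithin_of_isOpen γ hsO_open) hysO] at hleib
  refine hleib.trans ?_
  -- the scales to compare
  set t : ℝ := layerScale n (min k k₀) with ht_def
  set t' : ℝ := layerScale n (max k k₀) with ht'_def
  have ht'0 : 0 < t' := layerScale_pos n _
  have htt' : t' < t := layerScale_lt_of_lt n (by omega)
  have htn : 2 ^ n * t ≤ 1 := two_pow_mul_layerScale_le_one n _
  have hyR : ‖y - c‖ ≤ R := by
    have hd2 : infDist y K ≤ 2 * ρ :=
      (hdy.trans_le (div_le_self (by positivity) (one_le_pow₀ (by norm_num)))).le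
    have := norm_sub_center_le (c := c) hKc hR₀ hne hd2
    simpa [hR] using this
  have hseg : ∀ μ ∈ Icc (1 - 2 ^ n * t) (1 - t'), dil c μ y ∈ interior K :=
    segment_interior_of_infDist_lt hK hKc hne hball hr n (by omega : max k k₀ ≤ k₀ + 2) hdy8
  -- the extrapolation estimate for each order `β ≤ γ`
  have hdiff : ∀ β, β ≤ γ → ‖iteratedFDeriv ℝ β (fun x => approx f c n (layerScale n k) x -
      approx f c n (layerScale n k₀) x) y‖ ≤ Cmax * t ^ (n + 1) := by
    intro β hβ
    have hβk : ContDiffAt ℝ β (approx f c n (layerScale n k)) y :=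
      (contDiffAt_approx isOpen_interior hf' c n _ hgood_k).of_le (by exact_mod_cast le_top)
    have hβk₀ : ContDiffAt ℝ β (approx f c n (layerScale n k₀)) y :=
      (contDiffAt_approx isOpen_interior hf' c n _ hgood_k₀).of_le (by exact_mod_cast le_top)
    rw [fun_iteratedFDeriv_sub_apply hβk hβk₀]
    have key := hCx β y hyR t t' ht'0 htt' htn hseg
    rcases hk_cases with hk1 | hk1
    · -- `k = k₀ - 1 < k₀`: `t = t_k`, `t' = t_{k₀}`
      have hmin : min k k₀ = k := by omega
      have hmax : max k k₀ = k₀ := by omega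
      rw [ht_def, hmin, ht'_def, hmax] at key
      rw [ht_def, hmin]
      exact key.trans (mul_le_mul_of_nonneg_right (hCx_le β hβ)
        (pow_nonneg (layerScale_pos n _).le _))
    · -- `k = k₀ + 1 > k₀`: `t = t_{k₀}`, `t' = t_k`
      have hmin : min k k₀ = k₀ := by omega
      have hmax : max k k₀ = k := by omega
      rw [ht_def, hmin, ht'_def, hmax] at key
      rw [ht_def, hmin, norm_sub_rev]
      exact key.trans (mul_le_mul_of_nonneg_right (hCx_le β hβ)
        (pow_nonneg (layerScale_pos n _).le _))
  -- the layer bounds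
  have hlayer : ∀ i, i ≤ γ → ‖iteratedFDeriv ℝ i (layer K ρ k) y‖ ≤ Lmax * A₀ * 2 ^ (k₀ * γ) := by
    intro i hi
    refine (norm_iteratedFDeriv_layer_le hρ k i hy).trans ?_
    -- `(2^k/ρ)^i ≤ A₀ 2^{k₀ γ}` using `2^k ≤ 2 · 2^{k₀}`
    have h2k : (2 : ℝ) ^ k ≤ 2 ^ (k₀ + 1) := pow_le_pow_right₀ (by norm_num) hk_le
    have hq : 2 ^ k / ρ ≤ 2 / ρ * 2 ^ k₀ := by
      rw [div_le_iff₀ hρ, pow_succ] at *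
      calc (2 : ℝ) ^ k ≤ 2 ^ k₀ * 2 := h2k
        _ = 2 / ρ * 2 ^ k₀ * ρ := by field_simp
    have hq0 : 0 ≤ 2 ^ k / ρ := by positivity
    have hstep : (2 ^ k / ρ) ^ i ≤ A₀ * 2 ^ (k₀ * γ) := by
      calc (2 ^ k / ρ) ^ i ≤ (2 / ρ * 2 ^ k₀) ^ i := pow_le_pow_left₀ hq0 hq i
        _ = (2 / ρ) ^ i * 2 ^ (k₀ * i) := by rw [mul_pow, ← pow_mul]
        _ ≤ max 1 ((2 / ρ) ^ i) * 2 ^ (k₀ * γ) :=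
            mul_le_mul (le_max_right _ _) (pow_le_pow_right₀ (by norm_num)
              (Nat.mul_le_mul_left k₀ hi)) (by positivity) (by positivity)
        _ ≤ A₀ * 2 ^ (k₀ * γ) := by
            refine mul_le_mul_of_nonneg_right ?_ (by positivity)
            rw [hA₀]
            refine max_le (le_max_left _ _) ((?_ : (2 / ρ) ^ i ≤ max 1 ((2 / ρ) ^ γ)))
            rcases le_or_gt 1 (2 / ρ) with h1 | h1
            · exact (pow_le_pow_right₀ h1 hi).trans (le_max_right _ _)
            · exact (pow_le_one₀ (by positivity) h1.le).trans (le_max_left _ _)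
    calc layerBound E i * (2 ^ k / ρ) ^ i ≤ Lmax * (A₀ * 2 ^ (k₀ * γ)) :=
          mul_le_mul (hL_le i hi) hstep (by positivity) hLmax0
      _ = Lmax * A₀ * 2 ^ (k₀ * γ) := by ring
  -- sum up
  have hterm : ∀ i ∈ range (γ + 1), (γ.choose i : ℝ) * ‖iteratedFDerivWithin ℝ i (layer K ρ k) sO y‖ *
      ‖iteratedFDerivWithin ℝ (γ - i) (fun x => approx f c n (layerScale n k) x -
        approx f c n (layerScale n k₀) x) sO y‖ ≤
      (γ.choose i : ℝ) * ((Lmax * A₀ * 2 ^ (k₀ * γ)) * (Cmax * t ^ (n + 1))) := by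
    intro i hi
    have hiγ : i ≤ γ := Nat.lt_succ_iff.1 (mem_range.1 hi)
    rw [(iteratedFDerivWithin_of_isOpen i hsO_open) hysO,
      (iteratedFDerivWithin_of_isOpen (γ - i) hsO_open) hysO, mul_assoc]
    exact mul_le_mul_of_nonneg_left (mul_le_mul (hlayer i hiγ) (hdiff (γ - i) (Nat.sub_le γ i))
      (norm_nonneg _) (by positivity)) (Nat.cast_nonneg (α := ℝ) _)
  refine (sum_le_sum hterm).trans ?_
  rw [← sum_mul]
  have hchoose : ∑ i ∈ range (γ + 1), (γ.choose i : ℝ) = 2 ^ γ := by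
    exact_mod_cast Nat.sum_range_choose γ
  rw [hchoose]
  -- `t ≤ 2 t_{k₀}` and `t^{n+1} ≤ t_{k₀}^{n+1} 2^{n+1}`, `2^{k₀ γ} t_{k₀}^{n+1} ≤ t_{k₀}... ≤ 1/2^{k₀}`
  have ht_le : t ≤ 2 * layerScale n k₀ := by
    rw [ht_def]
    rcases hk_cases with hk1 | hk1
    · have hmin : min k k₀ = k := by omega
      rw [hmin]
      rcases Nat.eq_zero_or_pos k₀ with h0 | h0
      · omega
      · have hk' : k₀ = k + 1 := by omega
        rw [hk', layerScale_succ]; linarith [layerScale_pos n k]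
    · have hmin : min k k₀ = k₀ := by omega
      rw [hmin]; linarith [layerScale_pos n k₀]
  have ht0 : 0 ≤ t := (layerScale_pos n _).le
  have htk₀ : layerScale n k₀ = 1 / (2 ^ n * 2 ^ k₀) := rfl
  have hpow : t ^ (n + 1) ≤ 2 ^ (n + 1) * (1 / (2 ^ n * 2 ^ k₀)) ^ (n + 1) := by
    rw [← mul_pow, ← htk₀]; exact pow_le_pow_left₀ ht0 ht_le _
  -- `2^{k₀ γ} (1/(2ⁿ 2^{k₀}))^{n+1} ≤ 1 / 2^{k₀}` since `γ ≤ n`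
  have hcore : (2 : ℝ) ^ (k₀ * γ) * (1 / (2 ^ n * 2 ^ k₀)) ^ (n + 1) ≤ 1 / 2 ^ k₀ := by
    rw [one_div_pow, mul_pow, ← pow_mul, ← pow_mul, mul_one_div, div_le_div_iff₀ (by positivity)
      (by positivity), one_mul]
    calc (2 : ℝ) ^ (k₀ * γ) * 2 ^ k₀ = 2 ^ (k₀ * γ + k₀) := by rw [pow_add]
      _ ≤ 2 ^ (n * (n + 1) + k₀ * (n + 1)) := pow_le_pow_right₀ (by norm_num) (by nlinarith)
      _ = 2 ^ (n * (n + 1)) * 2 ^ (k₀ * (n + 1)) := pow_add _ _ _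
  calc (2 : ℝ) ^ γ * (Lmax * A₀ * 2 ^ (k₀ * γ) * (Cmax * t ^ (n + 1)))
      = 2 ^ γ * Lmax * A₀ * Cmax * (2 ^ (k₀ * γ) * t ^ (n + 1)) := by ring
    _ ≤ 2 ^ γ * Lmax * A₀ * Cmax * (2 ^ (k₀ * γ) * (2 ^ (n + 1) * (1 / (2 ^ n * 2 ^ k₀)) ^ (n + 1))) := by
        gcongr
    _ = 2 ^ γ * Lmax * A₀ * Cmax * 2 ^ (n + 1) * (2 ^ (k₀ * γ) * (1 / (2 ^ n * 2 ^ k₀)) ^ (n + 1)) := by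
        ring
    _ ≤ 2 ^ γ * Lmax * A₀ * Cmax * 2 ^ (n + 1) * (1 / 2 ^ k₀) :=
        mul_le_mul_of_nonneg_left hcore (by positivity)
    _ = 2 ^ γ * Lmax * Cmax * 2 ^ (n + 1) * A₀ / 2 ^ k₀ := by ring

/-- **The key estimate.**  For `γ ≤ n` and `ε > 0` there is `δ > 0` such that
`‖Dᵞ (extOp f K c r n) y - Dᵞ_K f (b)‖ ≤ ε` whenever `y ∉ K`, `b ∈ K`, `d(y) < δ` and
`‖y - b‖ < δ` (see the module docstring for the proof). [folklore] -/
theorem norm_iteratedFDeriv_extOp_sub_le (γ : ℕ) (hγ : γ ≤ n) {ε : ℝ} (hε : 0 < ε) :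
    ∃ δ : ℝ, 0 < δ ∧ ∀ y : E, 0 < infDist y K → infDist y K < δ → ∀ b ∈ K, ‖y - b‖ < δ →
      ‖iteratedFDeriv ℝ γ (extOp f K c r n) y - iteratedFDerivWithin ℝ γ f K b‖ ≤ ε := by
  have hρ := baseScale_pos hr n
  set ρ := baseScale r n with hρ_def
  have hne : K.Nonempty := ⟨c, hball (mem_closedBall_self hr.le)⟩
  have hKu : UniqueDiffOn ℝ K :=
    uniqueDiffOn_convex hK ⟨c, interior_mono hball (by
      rw [interior_closedBall c hr.ne']; exact mem_ball_self hr)⟩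
  obtain ⟨R₀, hR₀0, hR₀⟩ := exists_radius (c := c) hKc
  set R : ℝ := R₀ + 1 with hR
  obtain ⟨C, hC0, hC⟩ := exists_bound_cross hK hKc hball hr hf γ hγ
  obtain ⟨δ₁, hδ₁, hbd⟩ := exists_boundary_bound hf hKu hKc c γ n R (half_pos hε)
  -- a threshold index `k*`
  obtain ⟨kstar, hkstar⟩ := pow_unbounded_of_one_lt (max (4 * C / ε) (1 / (2 ^ n * δ₁)))
    (by norm_num : (1 : ℝ) < 2)
  have hkC : 4 * C / ε < 2 ^ kstar := lt_of_le_of_lt (le_max_left _ _) hkstar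
  have hkδ : 1 / (2 ^ n * δ₁) < 2 ^ kstar := lt_of_le_of_lt (le_max_right _ _) hkstar
  have h2ks : (0 : ℝ) < 2 ^ kstar := by positivity
  set δ : ℝ := min (min δ₁ 1) (ρ / (16 * 2 ^ kstar)) with hδ
  have hδ0 : 0 < δ := by rw [hδ]; positivity
  have hδ₁' : δ ≤ δ₁ := (min_le_left _ _).trans (min_le_left _ _)
  have hδ1 : δ ≤ 1 := (min_le_left _ _).trans (min_le_right _ _)
  have hδρ : δ ≤ ρ / (16 * 2 ^ kstar) := min_le_right _ _
  refine ⟨δ, hδ0, fun y hy hyδ b hb hyb => ?_⟩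
  -- `Δ(y) < ρ / (2 · 2^{k*}) ≤ ρ / 2`
  have hΔ8 : regDist K y ≤ 8 * infDist y K := regDist_le hy
  have hΔs : regDist K y < ρ / (2 * 2 ^ kstar) := by
    calc regDist K y ≤ 8 * infDist y K := hΔ8
      _ < 8 * δ := by linarith
      _ ≤ 8 * (ρ / (16 * 2 ^ kstar)) := by linarith
      _ = ρ / (2 * 2 ^ kstar) := by ring
  have hΔρ : regDist K y < ρ := by
    refine hΔs.trans_le ?_
    rw [div_le_iff₀ (by positivity)]
    have := one_le_pow₀ (M₀ := ℝ) (a := 2) (n := kstar) (by norm_num)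
    nlinarith
  have hΔpos : 0 < regDist K y := regDist_pos hy
  obtain ⟨N, hN⟩ := exists_pow_mul_regDist_ge ρ hy 4
  -- an active layer `k₀`
  have hsum : ∑ k ∈ range N, layer K ρ k y = 1 := by
    rw [sum_range_layer hρ (by linarith), dyadicCutoff_of_le_one ((div_le_one hρ).2 hΔρ.le)]
  obtain ⟨k₀, hk₀N, hk₀⟩ : ∃ k₀ ∈ range N, layer K ρ k₀ y ≠ 0 :=
    exists_ne_zero_of_sum_ne_zero (by rw [hsum]; exact one_ne_zero)
  obtain ⟨hk₀l, hk₀u⟩ := regDist_mem_of_layer_ne_zero hρ hk₀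
  have h2k₀ : (0 : ℝ) < 2 ^ k₀ := by positivity
  -- `k* < k₀`
  have hks : (2 : ℝ) ^ kstar < 2 ^ k₀ := by
    by_contra hle
    have hle' : (2 : ℝ) ^ k₀ ≤ 2 ^ kstar := not_lt.1 hle
    have h1 : 2 ^ k₀ * regDist K y ≤ 2 ^ kstar * regDist K y :=
      mul_le_mul_of_nonneg_right hle' hΔpos.le
    have h2 : 2 ^ kstar * regDist K y < 2 ^ kstar * (ρ / (2 * 2 ^ kstar)) :=
      mul_lt_mul_of_pos_left hΔs h2ks
    have h3 : 2 ^ kstar * (ρ / (2 * 2 ^ kstar)) = ρ / 2 := by field_simp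
    linarith
  -- distances at `y`
  have hdy : infDist y K < 2 * ρ / 2 ^ k₀ := by
    refine (infDist_le_regDist hy).trans_lt ?_
    rw [lt_div_iff₀ h2k₀]; linarith
  have hdy8 : infDist y K < 8 * ρ / 2 ^ k₀ :=
    hdy.trans (div_lt_div_of_pos_right (by linarith) h2k₀)
  -- the derivative identity
  rw [iteratedFDeriv_extOp_eq hK hKc hball hr hf hy hΔρ hN hdy8 γ, add_sub_right_comm]
  refine (norm_add_le _ _).trans ?_
  have hhalf : ε = ε / 2 + ε / 2 := by ring
  rw [hhalf]
  refine add_le_add ?_ ?_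
  · -- the main term: boundary estimate at scale `t_{k₀}`
    have hyR : ‖y - c‖ ≤ R := norm_sub_center_le (c := c) hKc hR₀ hne (hyδ.le.trans hδ1)
    have htk₀ : layerScale n k₀ ≤ δ₁ := by
      have h1 : layerScale n k₀ ≤ layerScale n kstar :=
        layerScale_le_of_le n (le_of_lt (by
          by_contra h; exact absurd (pow_le_pow_right₀ (by norm_num : (1:ℝ) ≤ 2) (not_lt.1 h)) (not_le.2 hks)))
      refine h1.trans ?_
      unfold layerScale
      rw [div_lt_iff₀ (by positivity)] at hkδ
      rw [div_le_iff₀ (by positivity)]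
      nlinarith [pow_pos (two_pos : (0:ℝ) < 2) n]
    exact hbd y hyR b hb (hyb.le.trans hδ₁') _ (layerScale_pos n k₀).le htk₀
      (mem_goodSet_of_infDist_lt hK hKc hne hball hr n le_rfl hdy8)
  · -- the cross terms: only `k = k₀ ± 1` contribute, each at most `C / 2^{k₀}`
    set g : ℕ → E [×γ]→L[ℝ] F := fun k => iteratedFDeriv ℝ γ (fun x => layer K ρ k x •
      (approx f c n (layerScale n k) x - approx f c n (layerScale n k₀) x)) y with hg
    have hgb : ∀ k, ‖g k‖ ≤ C / 2 ^ k₀ := fun k => (hC k k₀ y hy hk₀l hk₀u).1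
    have hgz : ∀ k, (k ≠ k₀ - 1 ∧ k ≠ k₀ + 1) → g k = 0 := fun k hk => (hC k k₀ y hy hk₀l hk₀u).2 hk
    show ‖∑ k ∈ range N, g k‖ ≤ ε / 2
    set S := (range N).filter (fun k => k = k₀ - 1 ∨ k = k₀ + 1) with hS
    have hsplit : ∑ k ∈ range N, g k = ∑ k ∈ S, g k := by
      rw [← sum_filter_add_sum_filter_not (range N) (fun k => k = k₀ - 1 ∨ k = k₀ + 1) g]
      have h0 : ∑ k ∈ (range N).filter (fun k => ¬(k = k₀ - 1 ∨ k = k₀ + 1)), g k = 0 :=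
        sum_eq_zero fun k hk => hgz k (not_or.1 (mem_filter.1 hk).2)
      rw [h0, add_zero]
    have hcard : (#S : ℝ) ≤ 2 := by
      have h1 : S ⊆ ({k₀ - 1, k₀ + 1} : Finset ℕ) := fun k hk => by
        rcases (mem_filter.1 hk).2 with h | h <;> simp [h]
      exact_mod_cast (Finset.card_le_card h1).trans Finset.card_le_two
    rw [hsplit]
    calc ‖∑ k ∈ S, g k‖ ≤ ∑ k ∈ S, ‖g k‖ := norm_sum_le _ _
      _ ≤ ∑ k ∈ S, C / 2 ^ k₀ := sum_le_sum fun k _ => hgb k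
      _ = #S * (C / 2 ^ k₀) := by rw [sum_const, nsmul_eq_mul]
      _ ≤ 2 * (C / 2 ^ k₀) := mul_le_mul_of_nonneg_right hcard (by positivity)
      _ ≤ 2 * (C / 2 ^ kstar) := by
          refine mul_le_mul_of_nonneg_left (div_le_div_of_nonneg_left hC0 h2ks hks.le) (by norm_num)
      _ ≤ ε / 2 := by
          rw [div_lt_iff₀ hε] at hkC
          rw [mul_div_assoc', div_le_iff₀ h2ks]
          nlinarith

end Estimate

end Literature.Analysis.Calculus.WhitneyConvex
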